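import Literature.NumberTheory.EllipticCurves.UnramifiedPrimeTwist
import Literature.NumberTheory.EllipticCurves.H1UnramifiedFinite
import HarnessLib

/-!
# The Mazur–Rubin prime twist: at a place where the character is LOCALLY TRIVIAL the `𝔓`-Selmer local
# condition of `A_χ` IS the `p`-Selmer local condition of `E` (`H¹_𝒜(K_v, E[p]) = H¹_f(K_v, E[p])` for `v` split in `L/K`)

`Proofs` file (theorems only: no definition, no named fact, no `sorry`) for the prime-twist formalism of
`UnramifiedPrimeTwist.lean` (Mazur–Rubin 2007 §§3–5: `A_χ(X) = ker(trace) ⊂ ∏_{Gal(L/K)} E(X)` with the diagonal action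
`(γ • f) i = γ • f (i − χ γ)`, Def. 4.3 `PrimeTwist.selmerLocalKer W χ K_v` = the kernel of `H¹(K, E[p]) → H¹(K_v, A_χ)` along
`E[p] = A_χ[𝔓] ⊆ A_χ`). That file leaves the LOCAL COMPARISONS `PrimeTwist.selmerLocalKer W χ K_v = W.selmerLocalKer K_v p` as
«the arithmetic input» of its `PrimeTwist.selmerGroup_eq_selmerGroup` (MR Cor. 4.6 / Prop. 1.3). This file proves the first of them:

* `PrimeTwist.selmerLocalKer_le_of_localChar_eq_one`, `PrimeTwist.le_selmerLocalKer_of_localChar_eq_one`,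
  **`PrimeTwist.selmerLocalKer_eq_of_localChar_eq_one`** — if `χ` is trivial on the decomposition group at the `K`-field `F`
  (`χ ∘ (Γ_F → Γ_K) = 1`: the place SPLITS COMPLETELY in `L/K`, e.g. `v ∣ ∞` for `L` real at `v`, or `d ∈ K_v^{×2}` for the quadratic
  character of `K(√d)`), then `PrimeTwist.selmerLocalKer W χ F = W.selmerLocalKer F p` inside `H¹(K, E[p])`.

Proof (cocycle criterion `oneCocycleClass_mem_resKer_iff`, no duality): with `χ_F = 1` the action on `A_χ(K̄_F) ⊂ ∏_i E(K̄_F)` is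
coordinatewise. If `c|_{Γ_F} = ∂f` in `A_χ(K̄_F)` then `c|_{Γ_F} = ∂(f 0)` in `E(K̄_F)` (evaluate at the coordinate `0`); conversely if
`c|_{Γ_F} = ∂Q` in `E(K̄_F)` then `c|_{Γ_F} = ∂f` for `f = (Q − pQ, Q, …, Q) ∈ A_χ(K̄_F)` (trace `pQ − pQ = 0`), because the values of
`c` are `p`-torsion. This is the «`A_L ⊗ K_v ≅ E^{p−1}` at a split place» sentence of Mazur–Rubin 2007 §5 / the case `v` split of
Def. 4.3's `H¹_𝒜`, in the tree's cocycle currency. Consumers (cell `bsd-f1-sign2`, `p = 2`, `χ` = the quadratic character of `ℚ(√d)`):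
the DESC-§17-R / T-2q / U′ dictionaries between `PrimeTwist.selmerGroup W χ` and the model-twist Selmer groups at the places `v = 2`
(`d ≡ 1 mod 8`), the odd bad primes (`(d/ℓ) = 1`) and the good primes with `(d/q) = 1`.

## References
* [MazurRubin2007] B. Mazur, K. Rubin, *Finding large Selmer rank via an arithmetic theory of local constants*, Ann. of Math. 166
  (2007), arXiv:math/0512085: §3 (Def. 3.3, Thm. 3.4), Def. 4.3, §5 (the local conditions at `v ∈ S`, split places).
* [SerreGaloisCohomology1997] J.-P. Serre, *Galois Cohomology*, I.§2.4, I.§5.1 (compatible pairs; cocycles).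
-/

noncomputable section

open scoped Classical
open scoped AddSubgroup

universe u

namespace Literature.NumberTheory.EllipticCurves

namespace PrimeTwist

variable {K : Type u} [Field K] (W : WeierstrassCurve K) {p : ℕ} [Fact p.Prime]
variable (χ : Field.absoluteGaloisGroup K →ₜ* Multiplicative (ZMod p))
variable (F : Type u) [Field F] [Algebra K F]

/-- With `χ` trivial on `Γ_F`, the exponent `χ_F(τ) ∈ ZMod p` of the local character vanishes. [cite: MazurRubin2007, §5] -/
theorem expo_localChar_eq_zero_of_localChar_eq_one
    (hχ : ∀ τ : Field.absoluteGaloisGroup F, χ (resGal (K := K) F τ) = 1) (τ : Field.absoluteGaloisGroup F) :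
    ResPoints.expo (localChar χ F) τ = 0 := by
  change Multiplicative.toAdd ((χ : Field.absoluteGaloisGroup K →* Multiplicative (ZMod p)) (resGal (K := K) F τ)) = 0
  have h1 : (χ : Field.absoluteGaloisGroup K →* Multiplicative (ZMod p)) (resGal (K := K) F τ) = 1 := hχ τ
  rw [h1]
  rfl

/-- With `χ` trivial on `Γ_F`, the action of `Γ_F` on `A_χ(K̄_F) ⊂ ∏_i E(K̄_F)` is COORDINATEWISE: `(τ • f) i = τ • f i`
(`(γ • f) i = γ • f (i − χ γ)` with `χ γ = 0`). [cite: MazurRubin2007, Prop 3.1 and §5] -/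
theorem coe_smul_apply_of_localChar_eq_one
    (hχ : ∀ τ : Field.absoluteGaloisGroup F, χ (resGal (K := K) F τ) = 1) (τ : Field.absoluteGaloisGroup F)
    (f : localModule W χ F) (i : ZMod p) :
    ((τ • f : localModule W χ F) : ResPoints (localChar χ F) (localPoints W F)) i =
      τ • (f : ResPoints (localChar χ F) (localPoints W F)) i := by
  rw [points.coe_smul, ResPoints.smul_apply', expo_localChar_eq_zero_of_localChar_eq_one χ F hχ τ, sub_zero]

/-- The composite `E[p] → A_χ(K̄) → A_χ(K̄_F)` (constant embedding, then localisation) evaluated at a coordinate is the localisation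
`E[p] ⊆ E(K̄) → E(K̄_F)` of points (`pushforward_apply`, `constEmb_apply`). [cite: MazurRubin2007, Remark 4.2 and §5] -/
theorem coe_locMap_constEmb_apply (P : W.geomTorsion (p : ℤ)) (i : ZMod p) :
    (((locMap W χ F).comp (constEmb _ W.geomPoints) P : localModule W χ F) :
        ResPoints (localChar χ F) (localPoints W F)) i = pointsMap W F (P : W.geomPoints) := by
  rw [AddMonoidHom.comp_apply]
  exact pushforward_apply _ _ _ _ (constEmb _ W.geomPoints P) i

/-- **`H¹_𝒜(K_v) ≤ H¹_f(K_v)` at a split place**: if `χ` is trivial on `Γ_F`, every class of `H¹(K, E[p])` in the `𝔓`-Selmer local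
condition of `A_χ` at `F` lies in the `p`-Selmer local condition of `E` at `F` (evaluate the bounding cochain at the coordinate `0`).
[cite: MazurRubin2007, Def 4.3 and §5] -/
theorem selmerLocalKer_le_of_localChar_eq_one
    (hχ : ∀ τ : Field.absoluteGaloisGroup F, χ (resGal (K := K) F τ) = 1) :
    selmerLocalKer W χ F ≤ W.selmerLocalKer F p := by
  intro c hc
  obtain ⟨φ, rfl⟩ := GaloisRepresentations.oneCocycleClass_surjective
    (discreteTopRep (Field.absoluteGaloisGroup K) (W.geomTorsion (p : ℤ))) c
  obtain ⟨f, hf⟩ := (oneCocycleClass_mem_resKer_iff _ _ _ φ).mp hc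
  refine (oneCocycleClass_mem_resKer_iff _ _ _ φ).mpr
    ⟨(f : ResPoints (localChar χ F) (localPoints W F)) 0, fun τ ↦ ?_⟩
  have h0 := congrArg (fun g : localModule W χ F ↦ (g : ResPoints (localChar χ F) (localPoints W F)) 0) (hf τ)
  simp only at h0
  rw [coe_locMap_constEmb_apply, AddSubgroupClass.coe_sub, ResPoints.sub_apply,
    coe_smul_apply_of_localChar_eq_one W χ F hχ] at h0
  rw [AddMonoidHom.comp_apply]
  exact h0

/-- **`H¹_f(K_v) ≤ H¹_𝒜(K_v)` at a split place**: if `χ` is trivial on `Γ_F` and `c|_{Γ_F} = ∂Q` in `E(K̄_F)`, then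
`c|_{Γ_F} = ∂f` in `A_χ(K̄_F)` for `f = (Q − p•Q, Q, …, Q)` (trace `0`; the correction `p•Q` is invisible because the values of `c`
are `p`-torsion: `p • (τ • Q − Q) = p • c(τ) = 0`). [cite: MazurRubin2007, Def 4.3 and §5] -/
theorem le_selmerLocalKer_of_localChar_eq_one
    (hχ : ∀ τ : Field.absoluteGaloisGroup F, χ (resGal (K := K) F τ) = 1) :
    W.selmerLocalKer F p ≤ selmerLocalKer W χ F := by
  intro c hc
  obtain ⟨φ, rfl⟩ := GaloisRepresentations.oneCocycleClass_surjective
    (discreteTopRep (Field.absoluteGaloisGroup K) (W.geomTorsion (p : ℤ))) c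
  obtain ⟨Q, hQ⟩ := (oneCocycleClass_mem_resKer_iff _ _ _ φ).mp hc
  -- the values of `φ` are `p`-torsion, hence so are the `τ • Q - Q`
  have hpQ : ∀ τ : Field.absoluteGaloisGroup F, p • (τ • Q - Q) = 0 := fun τ ↦ by
    rw [← hQ τ, AddMonoidHom.comp_apply, ← map_nsmul, AddSubgroup.coe_subtype, ← AddSubgroupClass.coe_nsmul,
      AddSubgroup.torsionBy.nsmul, AddSubgroup.coe_zero, map_zero]
  -- the bounding cochain `f = (Q - p•Q, Q, …, Q) ∈ A_χ(K̄_F)`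
  let g : ResPoints (localChar χ F) (localPoints W F) := ⟨fun i ↦ Q - if i = 0 then p • Q else 0⟩
  have hg : g ∈ points (localChar χ F) (localPoints W F) := by
    rw [mem_points_iff]
    simp only [g, ResPoints.mk_apply, Finset.sum_sub_distrib, Finset.sum_ite_eq', Finset.mem_univ, if_true,
      Finset.sum_const, Finset.card_univ, ZMod.card, sub_self]
  refine (oneCocycleClass_mem_resKer_iff _ _ _ φ).mpr ⟨⟨g, hg⟩, fun τ ↦ ?_⟩
  apply Subtype.ext
  apply ResPoints.ext
  intro i
  rw [coe_locMap_constEmb_apply, AddSubgroupClass.coe_sub, ResPoints.sub_apply,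
    coe_smul_apply_of_localChar_eq_one W χ F hχ]
  change pointsMap W F ((φ.1 (resGal (K := K) F τ) : W.geomTorsion (p : ℤ)) : W.geomPoints) = τ • g i - g i
  have hφ : pointsMap W F ((φ.1 (resGal (K := K) F τ) : W.geomTorsion (p : ℤ)) : W.geomPoints) = τ • Q - Q := by
    rw [← hQ τ, AddMonoidHom.comp_apply, AddSubgroup.coe_subtype]
  by_cases hi : i = 0
  · simp only [g, ResPoints.mk_apply, hi, if_true, smul_sub]
    rw [hφ, smul_comm τ p Q]
    have := hpQ τ
    rw [smul_sub] at this
    -- `τ•Q - p•τ•Q - (Q - p•Q) = (τ•Q - Q) - (p•τ•Q - p•Q) = (τ•Q - Q) - 0`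
    rw [sub_sub_sub_comm, this, sub_zero]
  · simp only [g, ResPoints.mk_apply, hi, if_false, sub_zero]
    exact hφ

/-- **THE LOCAL COMPARISON AT A SPLIT PLACE: `H¹_𝒜(K_v, E[p]) = H¹_f(K_v, E[p])`.** For the Mazur–Rubin twist `A_χ` of `E/K` by a
degree-`p` cyclic character `χ` and a `K`-field `F` (a completion `K_v`) on whose Galois group `χ` is trivial (the place splits completely in
`L/K`), the `𝔓`-Selmer local condition of `A_χ` and the `p`-Selmer local condition of `E` at `F` COINCIDE inside `H¹(K, E[p])` — the
hypothesis `hv v` / `hw w` of `PrimeTwist.selmerGroup_eq_selmerGroup` at such places. For `p = 2`, `χ` the character of `K(√d)`: every place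
where `d` is a local square (for `K = ℚ`, `d ≡ 1 (mod 8)`: `v = 2`; `(d/ℓ) = 1`: `v = ℓ`; `d > 0`: `v = ∞`).
[cite: MazurRubin2007, Def 4.3, Cor 4.6 and §5] -/
theorem selmerLocalKer_eq_of_localChar_eq_one
    (hχ : ∀ τ : Field.absoluteGaloisGroup F, χ (resGal (K := K) F τ) = 1) :
    selmerLocalKer W χ F = W.selmerLocalKer F p :=
  le_antisymm (selmerLocalKer_le_of_localChar_eq_one W χ F hχ) (le_selmerLocalKer_of_localChar_eq_one W χ F hχ)

end PrimeTwist

end Literature.NumberTheory.EllipticCurves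

end
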